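import Summits.BirchSwinnertonDyer.BirchSwinnertonDyer.Theorems.PrintCFramBottomClassIndexLawFiveLeGenusInternalHeegnerSevenIndex
import Summits.BirchSwinnertonDyer.Rank1Residual.X11b.BDPRoute
import Summits.BirchSwinnertonDyer.BirchSwinnertonDyer.Theorems.GoldfeldAllTwistsTwoConverseTwinBirchFixedCurve
import Summits.BirchSwinnertonDyer.BirchSwinnertonDyer.Theorems.GoldfeldAllTwistsTwoConverseTwinAdditiveRootNumber
import HarnessLib

/-!
# Crux `PrintCFram.BottomClassIndexLawFiveLe` (stmt-BirchSwinnertonDyer-20372), line `eisenstein-resource-bdp-line`,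
# branch «genus-internal Heegner fields» of `stub_seedOffExc` (idea card rev 2, critic V#146b (1)): THE `p`-PART OF THE
# HEEGNER-INDEX IDENTITY OVER `K` FROM KRIZ–LI'S UNIT LOGARITHM — the ideator's OPEN predicate
# `IndexIdentityAtCm7SevenOfLogUnit` PROVED, and its prime-generic form at any additive `p ≥ 5`

Width seat w3 g16 (prover-bsd-line-cfram-p1-w3-g16-0, 2026-08-29); helper `--supports stmt-BirchSwinnertonDyer-20372`;
theorems only (0 defs / 0 named facts / 0 sorry). Companion of `…GenusInternalDisplay.lean` (p703060: the parity-free,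
`d_K`-free display and the twist-up brick on the IDENTITY road): this file supplies that road's ONE socket
`hid : X11b.IndexIdentityAt V p K P` from the conclusion of Kriz–Li 2019 Thm. 1.20 AS TYPED
(`¬ ‖(|Ẽ^{ns}(𝔽_p)|/p)·(log_{ω_E} P / c)‖_p ≤ p⁻¹`), CONSUMING w6 g8's P1b (p703056
`…GenusInternalHeegnerSevenIndex`: `padicValNat_index_eq_zero_of_not_le_inv_of_addv` — unit log ⟹ `ord_p [E(K):ℤP] = 0`, NO
rank hypothesis —, `addv_cm7_seven`, `noSevenTorsion_cm7_baseChange`) BY NAME, as agreed on STATUS 06:28:37Z.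

* §1 `indexIdentityAt_of_not_le_inv_of_addv` — PRIME/CURVE-GENERIC: `V/ℚ` globally minimal with ADDITIVE reduction at `p ≥ 5`
  (`Addv V p`), a number field `K` with `ιp : K → ℚ_p`, ANY `P ∈ V(K)` satisfying Kriz–Li's conclusion at `(V, p, ιp, P, c)` for
  an integer `c` with `p ∤ c`, `V(K)[p] = 0`, `p ∤ ∏_ℓ c_ℓ(V)` and `ord_p #Ш(V/K) = 0` ⟹ `X11b.IndexIdentityAt V p K P`
  (`2·ord_p ∏c + ord_p #Ш(V/K) = 2·ord_p [V(K):ℤP]`: every term `0`; the index term by P1b).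
* §2 **`indexIdentityAt_cm7_seven_of_logUnit`** = the ideator's predicate `GenusInternalHeegnerFields.IndexIdentityAtCm7SevenOfLogUnit`
  (crux workfile `Cruxes/BottomClassIndexLawFiveLe/GenusInternalHeegnerFields.lean` §2, bsd-idea-7 g20) with its binders VERBATIM,
  PROVED: for `K` imaginary quadratic with the Heegner hypothesis for `49`, a level-`49` datum `Dt` with `7 ∤ c(Dt)`, `H`, `ι`,
  `ιp`, the Heegner point `P` with unit `7`-adic logarithm, `rank_ℤ X₀(49)(K) = 1` and `7 ∤ #Ш(X₀(49)/K)`: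
  `X11b.IndexIdentityAt cm7 7 K P`. (`∏c_ℓ(49a1) = 2`: bsd-goldfeld `tamagawaProduct_cm7`; `Addv cm7 7`, `X₀(49)(K)[7] = 0`: P1b.)
  The binders `H, ι, hP`, `IsImaginaryQuadratic K`, the Heegner hypothesis AND `mordellWeilRank = 1` are carried for literal
  agreement with the predicate and are NOT used (P1b's index lemma is rank-free: an infinite index reads `0`);
  `indexIdentityAt_cm7_seven_of_not_le_inv` is the trimmed form (any `P`, any `c` with `7 ∤ c`, no datum, no rank).

With `…GenusInternalDisplay.bsdp_twist_cm7_of_indexIdentityAt` (p703060) this closes the identity road of the branch up to its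
named facts, the unit logarithm (w6 g8 P1 p702209 / ideator §1: Kriz–Li Thm. 1.20 at `(X₀(49), 7, ω²)` from class regularity)
and the Ш-input `7 ∤ #Ш(X₀(49)/K)` (`Ш(E/K)[7^∞] ≅ Ш(49a1)[7^∞] ⊕ Ш(W)[7^∞]`, rank-zero `BSD(49a1,7)`, the cell's regular-member
Selmer count). HONEST FRAMING: bookkeeping at the additive prime; nothing here proves BSD for any curve or any registered stub;
`stub_seedOffExc` is untouched; adoption of the branch is the LEAD's call. No summit statement is proved by this seat.

References: [KrizLi2019] Thm. 1.20, Rem. 1.17, Rem. 3.10, §10.3; [GrossLMS1991] §2 (2.2); [Castella2018] (5.3);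
[Mazur1977] III §5; [SilvermanAEC2009] IV.6.4, VII.6.3.
-/
set_option autoImplicit false

-- `Summit.BirchSwinnertonDyer.BirchSwinnertonDyer.…`: the summit and its single sub-problem share a name.
set_option linter.dupNamespace false

noncomputable section

open scoped Classical

open WeierstrassCurve NumberField
  Literature.NumberTheory.EllipticCurves
  Literature.NumberTheory.EllipticCurves.ModularForms
  Literature.NumberTheory.EllipticCurves.KrizLi2019
  Literature.NumberTheory.EllipticCurves.Rank1Residual
  Summit.BirchSwinnertonDyer.Rank1Residual
  Summit.BirchSwinnertonDyer.Rank1Residual.X12.O11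

namespace Summit.BirchSwinnertonDyer.BirchSwinnertonDyer.Theorems.PrintCFram.GenusInternal

/-! ## §1. Prime-generic: Kriz–Li's printed conclusion at an additive `p ≥ 5` ⟹ the Heegner-index identity over `K` -/

/-- **`X11b.IndexIdentityAt V p K P` from Kriz–Li's printed conclusion at an additive `p ≥ 5` (prime- and curve-generic, any
point, no rank hypothesis).** For `V/ℚ` globally minimal with `Addv V p`, `5 ≤ p`, a number field `K` with `ιp : K → ℚ_p`,
`P ∈ V(K)` and an integer `c` with `p ∤ c` such that `¬ ‖(|Ẽ^{ns}(𝔽_p)|/p)·(log_{ω_E} P_{ιp} / c)‖_p ≤ p⁻¹` (the conclusion of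
Thm. 1.20 AS TYPED), `V(K)[p] = 0`, `p ∤ ∏_ℓ c_ℓ(V/ℚ)` and `ord_p #Ш(V/K) = 0`:
`2·ord_p ∏c_ℓ(V) + ord_p #Ш(V/K) = 2·ord_p [V(K) : ℤ·P]` — every term is `0`, the index term by w6 g8's P1b
`padicValNat_index_eq_zero_of_not_le_inv_of_addv` (unit log ⟹ unit index; an infinite index reads `0`). This is the `hid`
socket of the identity-road display (`displaySwap_of_indexIdentityAt_of_five_le`, bsd-eis `displaySwap_of_indexIdentityAt`).
[cite: KrizLi2019, Thm. 1.20 (pp. 7–8), Rem. 3.10 (p. 26), §10.3] [cite: GrossLMS1991, §2 Conj. (2.2)]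
[cite: Castella2018, (5.3) (p. 12)] -/
theorem indexIdentityAt_of_not_le_inv_of_addv
    (V : WeierstrassCurve ℚ) [V.IsElliptic] [V.IsGloballyMinimal] (p : ℕ) [Fact p.Prime]
    (hadd : Addv V p) (hp5 : 5 ≤ p)
    {K : Type} [Field K] [NumberField K] (ιp : K →+* ℚ_[p]) (P : (V.baseChange K).toAffine.Point)
    {c : ℤ} (hc : ¬ (p : ℤ) ∣ c)
    (hunit : ¬ ‖((nsPointCount V p : ℤ) : ℚ_[p]) / (p : ℚ_[p]) *
        (Castella2018.padicLogOmega V p ιp P / (c : ℚ_[p]))‖ ≤ (p : ℝ)⁻¹)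
    (htors : ∀ x : (V.baseChange K).toAffine.Point, p • x = 0 → x = 0)
    (htam : ¬ p ∣ V.tamagawaProduct) (hsha : padicValNat p (V.baseChange K).shaOrder = 0) :
    X11b.IndexIdentityAt V p K P := by
  rw [X11b.indexIdentityAt_iff, padicValNat.eq_zero_of_not_dvd htam, hsha,
    padicValNat_index_eq_zero_of_not_le_inv_of_addv V p ιp P hadd hp5 hc htors hunit]

/-! ## §2. `X₀(49)` at `p = 7`: the trimmed form, and the ideator's predicate PROVED verbatim -/

/-- **The Heegner-index identity over `K` for `X₀(49)` at `7`, trimmed form.** For any number field `K ↪ ℚ₇`, ANY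
`P ∈ X₀(49)(K)` and any integer `c` with `7 ∤ c` such that `¬ ‖(|Ẽ^{ns}(𝔽₇)|/7)·(log_{ω_E} P / c)‖₇ ≤ 7⁻¹`, and
`ord₇ #Ш(X₀(49)/K) = 0`: `X11b.IndexIdentityAt cm7 7 K P`. Inputs: `Addv cm7 7`, `X₀(49)(K)[7] = 0` (P1b `addv_cm7_seven`,
`noSevenTorsion_cm7_baseChange`), `∏c_ℓ(49a1) = 2` (`GoldfeldGoodTwists.tamagawaProduct_cm7`).
[cite: KrizLi2019, Thm. 1.20 and §10.3] [cite: Castella2018, (5.3) (p. 12)] -/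
theorem indexIdentityAt_cm7_seven_of_not_le_inv
    {K : Type} [Field K] [NumberField K] (ιp : K →+* ℚ_[7]) (P : (cm7.baseChange K).toAffine.Point)
    {c : ℤ} (hc : ¬ (7 : ℤ) ∣ c)
    (hunit : ¬ ‖((nsPointCount cm7 7 : ℤ) : ℚ_[7]) / (7 : ℚ_[7]) *
        (Castella2018.padicLogOmega cm7 7 ιp P / (c : ℚ_[7]))‖ ≤ (7 : ℝ)⁻¹)
    (hsha : padicValNat 7 (cm7.baseChange K).shaOrder = 0) :
    X11b.IndexIdentityAt cm7 7 K P := by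
  haveI : Fact (Nat.Prime 7) := ⟨by norm_num⟩
  have htam : ¬ 7 ∣ cm7.tamagawaProduct := by
    rw [GoldfeldGoodTwists.tamagawaProduct_cm7]; norm_num
  exact indexIdentityAt_of_not_le_inv_of_addv cm7 7 addv_cm7_seven (by norm_num) ιp P
    (by exact_mod_cast hc) (by exact_mod_cast hunit) (noSevenTorsion_cm7_baseChange K ιp) htam hsha

/-- **The ideator's OPEN predicate `IndexIdentityAtCm7SevenOfLogUnit` (crux workfile `GenusInternalHeegnerFields.lean` §2,
bsd-idea-7 g20; critic V#146b (1)), PROVED — binders VERBATIM.** For `K` imaginary quadratic with the Heegner hypothesis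
for `49`, a level-`49` parametrisation datum `Dt` of `X₀(49) = cm7` with `7 ∤ c(Dt)`, a Heegner datum `H`, `ι : K → ℂ`,
`ιp : K → ℚ₇`, the point `P ∈ X₀(49)(K)` with `P ↦ heegnerPointComplex Dt H`, the conclusion of Kriz–Li Thm. 1.20 at
`(cm7, 7, ιp, P, Dt)` (unit `7`-adic logarithm), `rank_ℤ X₀(49)(K) = 1` and `ord₇ #Ш(X₀(49)/K) = 0`:
`X11b.IndexIdentityAt cm7 7 K P`, i.e. `2·ord₇ ∏c_ℓ(49a1) + ord₇ #Ш(E/K) = 2·ord₇ [E(K) : ℤP]`. Proof: the trimmed form; the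
Heegner data `(H, ι, hP)`, `IsImaginaryQuadratic K`, the Heegner hypothesis and the rank hypothesis are carried for literal
agreement with the predicate and not used (w6 g8's index lemma is rank-free). [cite: KrizLi2019, Thm. 1.20 (pp. 7–8), Rem. 3.10 (p. 26), §10.3]
[cite: GrossLMS1991, §2 Conj. (2.2)] [cite: Castella2018, (5.3) (p. 12)] -/
theorem indexIdentityAt_cm7_seven_of_logUnit :
    ∀ (K : Type) [Field K] [NumberField K],
      IsImaginaryQuadratic K → SatisfiesHeegnerHypothesis 49 K →
      ∀ (Dt : ModularParametrizationData cm7 49) (H : HeegnerDatum 49 (NumberField.discr K)) (ι : K →+* ℂ)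
        (ιp : K →+* ℚ_[7]) (P : (cm7.baseChange K).toAffine.Point),
        WeierstrassCurve.Affine.Point.map ι.toRatAlgHom P = heegnerPointComplex Dt H →
        ¬ (7 : ℤ) ∣ Dt.maninConstant →
        ¬ (‖((nsPointCount cm7 7 : ℤ) : ℚ_[7]) / ((7 : ℕ) : ℚ_[7]) *
              (Castella2018.padicLogOmega cm7 7 ιp P / (Dt.maninConstant : ℚ_[7]))‖ ≤ ((7 : ℕ) : ℝ)⁻¹) →
        (cm7.baseChange K).mordellWeilRank = 1 →
        padicValNat 7 (cm7.baseChange K).shaOrder = 0 →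
        X11b.IndexIdentityAt cm7 7 K P := by
  intro K _ _ _hK _hH Dt H ι ιp P _hP hc hunit _hrk hsha
  exact indexIdentityAt_cm7_seven_of_not_le_inv ιp P hc (by exact_mod_cast hunit) hsha

end Summit.BirchSwinnertonDyer.BirchSwinnertonDyer.Theorems.PrintCFram.GenusInternal

end
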